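import Summits.HubbardSuperconductivity.HubbardSuperconductivity.Theorems.WidthHaldaneEtaLowestWeight
import Summits.HubbardSuperconductivity.HubbardSuperconductivity.Theorems.WidthHaldaneBridgeSharpBloch
import Summits.HubbardSuperconductivity.HubbardSuperconductivity.Theorems.WidthHaldaneLeggettFloor
import Summits.HubbardSuperconductivity.HubbardSuperconductivity.Theorems.WidthHaldaneTransverseFloor
import Summits.HubbardSuperconductivity.HubbardSuperconductivity.Theorems.WidthHaldaneCurrentRigidity

/-!
# `Lines/Sketch.lean` — line `Sketch` (cards `twist-transfer-floors` + `pair-repulsion-dual`) for crux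
`WidthHaldaneBridge` (stmt-HubbardSuperconductivity-16311; routes `WidthHaldane` rank 2, `SeamInduction` rank 4)

Lead `prover-line-stmt-HubbardSuperconductivity-16311-a5-0`, 2026-08-17. The served line was the ideation sketch
`Cruxes/WidthHaldaneBridge/IdeaSketchR1K1.lean` (rc 0, 0 sorries, no `stub_*`); this file is the lead's REGISTERED
skeleton for it: every `sorry` lives in a `stub_*` theorem, and `WidthHaldaneBridge_of` concludes the crux BY NAME
(`Summit.HubbardSuperconductivity.HubbardSuperconductivity.Theses.WidthHaldane.WidthHaldaneBridge`) from the stubs, with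
all glue proved here. Statements are DEF-FREE over the landed vocabulary `Theorems/WidthHaldaneDefs.lean`
(`tubeH0`, `tubeTwist`, `tubeEnergy`, `tubeFilling`, `tubeStiffness`, `tubePairCompressibility`, `tubeColumnPairCorr`,
`UniformThermo`) so that each stub can be landed verbatim under `Theorems/` by a worker.

## The line

TRANSFER `UniformThermo` ONTO THE θ = 0 GROUND STATE (card `twist-transfer-floors`): the stiffness clause
`d₀ ≤ ρ̃_{L,M}` is an inequality between the sector minimum of the TWISTED tube and that of the untwisted one; pricing
gauge-rotated copies of an untwisted sector ground state `ψ` in the twisted tube (pure gauges are landed: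
`WidthHaldaneTubeGauge`, `…TubeStepGauge`, `…TubeTwoCut`; the `±θ` average kills the bond currents by
`tubeEnergy_neg`) turns it into explicit inequalities ON `ψ`:

* `stub_sharpBloch` (kinematic, UT-free): `E(θ) ≤ Re⟨ψ, H₀ψ⟩ + (1 - cos(θ/L))·K_ψ` for every unit sector vector, where
  `K_ψ = Σ_{a,b,σ} Re⟨ψ, (c†_{(a,b)σ} c_{(a-1,b)σ} + h.c.) ψ⟩` is the longitudinal kinetic energy (Bloch's bound
  `WidthHaldaneTubeBlochBound.tubeEnergy_le_rayleigh_add` with the actual `⟨K⟩_ψ` kept instead of `‖hop‖ ≤ ½`);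
* `stub_kineticFloor`: hence under UT every normalised sector ground state has `d₀·L·M ≤ K_ψ` (Scalapino–White–Zhang's
  `D_s/π ≤ ⟨-k_x⟩` read as a constraint on `ψ`);
* `stub_cutFloor` (no weak link): relocating the whole flux to ONE cut (`minEnergyOn_cut_eq_tubeEnergy`),
  `(π/3)²·d₀·M/L ≤ k_a(ψ)` at EVERY cut `a`;
* `stub_leggettFloor`: optimising the column profile (series resistors, Leggett 1970 / Paramekanti–Trivedi–Randeria 1998
  §IV), `d₀·M·Σ_a k_a(ψ)⁻¹ ≤ L`;
* `stub_currentRigidity` (Kohn's formula as an inequality): UT is the operator inequality `H₀ + T ≥ E₀ + c` on the sector,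
  `T = Σ_{x∼y,σ} (1 - ω_{π/3}(x,y)) c†_{xσ}c_{yσ}` the spread twist (`ω = e^{±iπ/(3L)}` on longitudinal bonds, `1`
  transversally), `c = d₀(π/3)²M/(2L)`; expanded around `ψ` it bounds the energy any sector vector `ζ ⊥ ψ` can recover by
  screening the twist;
* `stub_transverseFloor` (diagonal dividend): at `M = L` the labelling quantifier of UT contains the swapped labelling, so
  the kinetic floor holds through BOTH cycles of the square torus.

OPEN CORE `stub_twoFluidSelection` (held by the lead; conjecture-strength, recorded as such): a normalised sector ground
state of the isotropic pure tube obeying all the floors above and `η_ε ψ = 0` (landed: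
`WidthHaldaneEtaLowestWeight.etaLowestWeight`, from UT's `0 < ẽ″`) carries its stiffness in the coherent `B1g` column pair
channel with the Haldane exponent: the crux's floor `A·L·M²·r̂^{-Ξ√(ẽ″/ρ̃)/M} ≤ G_ψ(r)`. At `M = L` this contains d-wave
column-pair LRO of the square torus (Disproof §3): no engine for it exists; the dual (energy) reading of the same residual
is kernel-checked in `WidthHaldaneEnergyResponse.tubeColumnPairCorr_ge_of_energy_floor` (card `pair-repulsion-dual`).

## Composition

`WidthHaldaneBridge_of_stubs` / `WidthHaldaneBridge_of`: given UT at `(U, δ, d₀, k₀, M₁, L₀)`, take the selection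
stub's constants and enlarge the thresholds to `M₂ ⊔ M₁`, `L₁ ⊔ L₀ ⊔ 3`; at an admissible `(L, M, ψ)` discharge the
floors by the transfer stubs (UT covers `(L, M)`), positivity of the cut energies by `stub_cutFloor`, `ηψ = 0` by the
landed `etaLowestWeight` (`0 < δ`, `0 < ẽ″` from UT), and read off the law. Axioms of the glue: propext,
Classical.choice, Quot.sound (+ `sorryAx` through the stubs only).
-/

noncomputable section

namespace Summit.HubbardSuperconductivity.HubbardSuperconductivity.Cruxes.WidthHaldaneBridge.Lines.Sketch

set_option linter.dupNamespace false

open scoped BigOperators Classical Matrix ComplexConjugate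
open Matrix Literature.MathematicalPhysics.QuantumLattice
open Summit.HubbardSuperconductivity.HubbardSuperconductivity.Theorems.WidthHaldane
open Summit.HubbardSuperconductivity.HubbardSuperconductivity.Theses.WidthHaldane (WidthHaldaneBridge)

/-! ## Stubs (the only `sorry`s of this file) -/

/-- STUB 1 — CLOSED (landed `Theorems/WidthHaldaneBridgeSharpBloch.lean`, p156522; the doubled form is `WidthHaldaneKineticFloor.two_mul_tubeEnergy_le_kinetic`). Kinematic, UT-free. SHARP BLOCH PRICE: for `L ≥ 3`, every `U, θ, N`, every labelling and every
unit vector `ψ` of the sector `(N, S^z = 0)`,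
`E_{L,M}(U; θ, N) ≤ Re⟨ψ, H₀ ψ⟩ + (1 - cos(θ/L)) · Σ_{a,b,σ} Re⟨ψ, (c†_{(a,b)σ} c_{(a-1,b)σ} + c†_{(a-1,b)σ} c_{(a,b)σ}) ψ⟩`.
Proof route: `WidthHaldaneTubeBlochBound.re_expect_gauged_tubeH` for `±θ`, `tubeEnergy_neg`, `re_pm_pointwise`,
`peierlsWeight_re` (the `±` sum is EXACTLY `(2 - 2cos(θ/L))·K_ψ` in the ordered-pair form), then re-index the
longitudinal ordered pairs by columns (`WidthHaldaneTubeStepGauge.sum_cols_eq_sum_sum`). -/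
theorem stub_sharpBloch :
    ∀ (L M : ℕ) [NeZero L] [NeZero M] (Λ : Type) [LinearOrder Λ] [Fintype Λ] (e : Λ ≃ ZMod L × ZMod M),
      3 ≤ L → ∀ (U θ : ℝ) (N : ℕ) (ψ : Fock (Orb Λ)), ψ ∈ szSector N 0 → star ψ ⬝ᵥ ψ = 1 →
        tubeEnergy L M Λ e U θ N ≤
          (expect (tubeH0 L M Λ e U) ψ).re +
            (1 - Real.cos (θ / L)) *
              ∑ a : ZMod L, ∑ b : ZMod M, ∑ σ : Fin 2,
                (expect (creation (orb (e.symm (a, b)) σ) * annihilation (orb (e.symm (a - 1, b)) σ) +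
                  creation (orb (e.symm (a - 1, b)) σ) * annihilation (orb (e.symm (a, b)) σ)) ψ).re :=
  Summit.HubbardSuperconductivity.HubbardSuperconductivity.Theorems.WidthHaldane.stub_sharpBloch

/-- STUB 2 — CLOSED (conclusion landed as `WidthHaldaneKineticFloor.kineticFloor` by a parallel seat 10:54Z; registered closed form `Theorems/WidthHaldaneBridgeKineticFloor.lean`, p157095). KINETIC FLOOR: the sharp Bloch price (hypothesis, = STUB 1) and `UniformThermo` give, for every
admissible tube with `L ≥ 3` and every normalised sector ground state `ψ` of the untwisted tube,
`d₀ · L · M ≤ Σ_{a,b,σ} Re⟨ψ, (c†_{(a,b)σ} c_{(a-1,b)σ} + h.c.) ψ⟩` (if the kinetic sum were negative the price would give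
`E(π/3) ≤ E(0)`; else `1 - cos x ≤ x²/2`). -/
theorem stub_kineticFloor :
    (∀ (L M : ℕ) [NeZero L] [NeZero M] (Λ : Type) [LinearOrder Λ] [Fintype Λ] (e : Λ ≃ ZMod L × ZMod M),
      3 ≤ L → ∀ (U θ : ℝ) (N : ℕ) (ψ : Fock (Orb Λ)), ψ ∈ szSector N 0 → star ψ ⬝ᵥ ψ = 1 →
        tubeEnergy L M Λ e U θ N ≤
          (expect (tubeH0 L M Λ e U) ψ).re +
            (1 - Real.cos (θ / L)) *
              ∑ a : ZMod L, ∑ b : ZMod M, ∑ σ : Fin 2,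
                (expect (creation (orb (e.symm (a, b)) σ) * annihilation (orb (e.symm (a - 1, b)) σ) +
                  creation (orb (e.symm (a - 1, b)) σ) * annihilation (orb (e.symm (a, b)) σ)) ψ).re) →
    ∀ (U δ d₀ k₀ : ℝ) (M₁ L₀ : ℕ), 0 < d₀ → UniformThermo U δ d₀ k₀ M₁ L₀ →
      ∀ (L M : ℕ) [NeZero L] [NeZero M], Even L → Even M → M₁ ≤ M → M ≤ L → L₀ ≤ L → 3 ≤ L →
        ∀ (Λ : Type) [LinearOrder Λ] [Fintype Λ] (e : Λ ≃ ZMod L × ZMod M) (ψ : Fock (Orb Λ)),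
          star ψ ⬝ᵥ ψ = 1 → IsGroundStateInSector (tubeH0 L M Λ e U) (tubeFilling L M δ) 0 ψ →
            d₀ * (L : ℝ) * (M : ℝ) ≤
              ∑ a : ZMod L, ∑ b : ZMod M, ∑ σ : Fin 2,
                (expect (creation (orb (e.symm (a, b)) σ) * annihilation (orb (e.symm (a - 1, b)) σ) +
                  creation (orb (e.symm (a - 1, b)) σ) * annihilation (orb (e.symm (a, b)) σ)) ψ).re :=
  fun _ => Summit.HubbardSuperconductivity.HubbardSuperconductivity.Theorems.WidthHaldane.kineticFloor

/-- STUB 3 — CLOSED (landed `Theorems/WidthHaldaneLeggettFloor.lean`, p156925, `cutFloor_of_stiffness`). NO WEAK CUT: under `UniformThermo`, for every admissible tube with `L ≥ 3`, every normalised sector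
ground state `ψ` and EVERY cut `a` (the `M` bonds `(a-1,b)—(a,b)`),
`(π/3)² · d₀ · M / L ≤ k_a(ψ) = Σ_{b,σ} Re⟨ψ, (c†_{(a,b)σ} c_{(a-1,b)σ} + h.c.) ψ⟩`.
Proof route: put the whole flux `±π/3` on the cut `a` (`WidthHaldaneTubeTwoCut.minEnergyOn_cut_eq_tubeEnergy` for
`a ≠ 0`; the seam itself, `expect_tubeTwist`, for `a = 0`), price `ψ`, average `±` with `tubeEnergy_neg`:
`E(π/3) - E(0) ≤ (1 - cos(π/3))·k_a = k_a/2`, and `UniformThermo` gives `d₀(π/3)²M/(2L) ≤ E(π/3) - E(0)`. -/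
theorem stub_cutFloor :
    ∀ (U δ d₀ k₀ : ℝ) (M₁ L₀ : ℕ), 0 < d₀ → UniformThermo U δ d₀ k₀ M₁ L₀ →
      ∀ (L M : ℕ) [NeZero L] [NeZero M], Even L → Even M → M₁ ≤ M → M ≤ L → L₀ ≤ L → 3 ≤ L →
        ∀ (Λ : Type) [LinearOrder Λ] [Fintype Λ] (e : Λ ≃ ZMod L × ZMod M) (ψ : Fock (Orb Λ)),
          star ψ ⬝ᵥ ψ = 1 → IsGroundStateInSector (tubeH0 L M Λ e U) (tubeFilling L M δ) 0 ψ →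
            ∀ a : ZMod L,
              (Real.pi / 3) ^ 2 * d₀ * (M : ℝ) / (L : ℝ) ≤
                ∑ b : ZMod M, ∑ σ : Fin 2,
                  (expect (creation (orb (e.symm (a, b)) σ) * annihilation (orb (e.symm (a - 1, b)) σ) +
                    creation (orb (e.symm (a - 1, b)) σ) * annihilation (orb (e.symm (a, b)) σ)) ψ).re :=
  Summit.HubbardSuperconductivity.HubbardSuperconductivity.Theorems.WidthHaldane.stub_cutFloor

/-- STUB 4 — CLOSED (landed `Theorems/WidthHaldaneLeggettFloor.lean`, p156925, `leggettFloor_of_stiffness`, over `WidthHaldaneTubeProfileGauge` / `WidthHaldaneLeggettBound`). LEGGETT'S HARMONIC-MEAN FLOOR (series resistors): under `UniformThermo`, for every admissible tube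
with `L ≥ 3` and every normalised sector ground state `ψ` whose cut kinetic energies `k_a(ψ)` are all positive
(supplied by STUB 3), `d₀ · M · Σ_a k_a(ψ)⁻¹ ≤ L`.
Proof route: conjugate the `π/3`-twisted tube by the column-profile gauge `g_z = e^{iΦ(z₁)}` (general `Φ` on the
representatives `0,…,L-1`; the pointwise coefficient identity is `WidthHaldaneTubeGauge.gauge_pointwise` with the linear
profile replaced by `Φ`), price `ψ`, average `±` (`tubeEnergy_neg`): `E(π/3) - E(0) ≤ Σ_a (1 - cos φ_a) k_a` for every
increment profile with `Σ_a φ_a = π/3`; bound `1 - cos φ ≤ φ²/2` and choose `φ_a ∝ k_a⁻¹`. -/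
theorem stub_leggettFloor :
    ∀ (U δ d₀ k₀ : ℝ) (M₁ L₀ : ℕ), 0 < d₀ → UniformThermo U δ d₀ k₀ M₁ L₀ →
      ∀ (L M : ℕ) [NeZero L] [NeZero M], Even L → Even M → M₁ ≤ M → M ≤ L → L₀ ≤ L → 3 ≤ L →
        ∀ (Λ : Type) [LinearOrder Λ] [Fintype Λ] (e : Λ ≃ ZMod L × ZMod M) (ψ : Fock (Orb Λ)),
          star ψ ⬝ᵥ ψ = 1 → IsGroundStateInSector (tubeH0 L M Λ e U) (tubeFilling L M δ) 0 ψ →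
            (∀ a : ZMod L, 0 < ∑ b : ZMod M, ∑ σ : Fin 2,
              (expect (creation (orb (e.symm (a, b)) σ) * annihilation (orb (e.symm (a - 1, b)) σ) +
                creation (orb (e.symm (a - 1, b)) σ) * annihilation (orb (e.symm (a, b)) σ)) ψ).re) →
            d₀ * (M : ℝ) * ∑ a : ZMod L, (∑ b : ZMod M, ∑ σ : Fin 2,
              (expect (creation (orb (e.symm (a, b)) σ) * annihilation (orb (e.symm (a - 1, b)) σ) +
                creation (orb (e.symm (a - 1, b)) σ) * annihilation (orb (e.symm (a, b)) σ)) ψ).re)⁻¹ ≤ (L : ℝ) :=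
  Summit.HubbardSuperconductivity.HubbardSuperconductivity.Theorems.WidthHaldane.stub_leggettFloor

/-- STUB 5 — CLOSED (landed `Theorems/WidthHaldaneCurrentRigidity.lean`, 11:26Z, `currentRigidity_of_stiffness` over the operator identity `gauged_tubeH_eq`). CURRENT RIGIDITY (Kohn's formula as an inequality, full variational form). Let
`T = Σ_{x∼y,σ} (1 - ω(x,y)) c†_{xσ} c_{yσ}` be the uniformly spread `π/3` twist (`ω = e^{+iπ/(3L)}` if `x = y + e₁`,
`e^{-iπ/(3L)}` if `y = x + e₁`, `1` on transverse bonds — the weights of `WidthHaldaneTubeGauge.expect_gauged_tubeH`), so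
that `⟨φ, W (H₀ + Tw_{π/3}) Wᴴ φ⟩ = ⟨φ, (H₀ + T) φ⟩` for the twist gauge `W`. `UniformThermo` says `H₀ + T ≥ E₀ + c` on the
sector `(N_{L,M}, 0)` as quadratic forms, `c = d₀(π/3)²M/(2L)`; at `φ = ψ + ζ` with `ψ` a normalised sector ground state and
`ζ ⊥ ψ` in the sector this is the displayed inequality (its supremum over `ζ` is the second-order energy the system could
recover by screening the twist). -/
theorem stub_currentRigidity :
    ∀ (U δ d₀ k₀ : ℝ) (M₁ L₀ : ℕ), 0 < d₀ → UniformThermo U δ d₀ k₀ M₁ L₀ →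
      ∀ (L M : ℕ) [NeZero L] [NeZero M], Even L → Even M → M₁ ≤ M → M ≤ L → L₀ ≤ L → 3 ≤ L →
        ∀ (Λ : Type) [LinearOrder Λ] [Fintype Λ] (e : Λ ≃ ZMod L × ZMod M) (ψ ζ : Fock (Orb Λ)),
          star ψ ⬝ᵥ ψ = 1 → IsGroundStateInSector (tubeH0 L M Λ e U) (tubeFilling L M δ) 0 ψ →
            ζ ∈ szSector (tubeFilling L M δ) (0 : ℝ) → star ζ ⬝ᵥ ψ = 0 →
              -(2 * (star ζ ⬝ᵥ ((∑ x : Λ, ∑ y : Λ, ∑ σ : Fin 2,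
                  (if (tubeGraph e).Adj x y then
                    (1 - (if (e x).1 = (e y).1 + 1 ∧ (e x).2 = (e y).2
                        then Complex.exp (((Real.pi / 3 / L : ℝ) : ℂ) * Complex.I)
                      else if (e y).1 = (e x).1 + 1 ∧ (e x).2 = (e y).2
                        then Complex.exp (-(((Real.pi / 3 / L : ℝ) : ℂ) * Complex.I))
                      else 1)) • (creation (orb x σ) * annihilation (orb y σ))
                  else 0)) *ᵥ ψ)).re) -
                (star ζ ⬝ᵥ ((tubeH0 L M Λ e U + ∑ x : Λ, ∑ y : Λ, ∑ σ : Fin 2,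
                  (if (tubeGraph e).Adj x y then
                    (1 - (if (e x).1 = (e y).1 + 1 ∧ (e x).2 = (e y).2
                        then Complex.exp (((Real.pi / 3 / L : ℝ) : ℂ) * Complex.I)
                      else if (e y).1 = (e x).1 + 1 ∧ (e x).2 = (e y).2
                        then Complex.exp (-(((Real.pi / 3 / L : ℝ) : ℂ) * Complex.I))
                      else 1)) • (creation (orb x σ) * annihilation (orb y σ))
                  else 0)) *ᵥ ζ)).re +
                (tubeEnergy L M Λ e U 0 (tubeFilling L M δ) + d₀ * (Real.pi / 3) ^ 2 * (M : ℝ) / (2 * (L : ℝ))) *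
                  (star ζ ⬝ᵥ ζ).re ≤
              (expect (∑ x : Λ, ∑ y : Λ, ∑ σ : Fin 2,
                  (if (tubeGraph e).Adj x y then
                    (1 - (if (e x).1 = (e y).1 + 1 ∧ (e x).2 = (e y).2
                        then Complex.exp (((Real.pi / 3 / L : ℝ) : ℂ) * Complex.I)
                      else if (e y).1 = (e x).1 + 1 ∧ (e x).2 = (e y).2
                        then Complex.exp (-(((Real.pi / 3 / L : ℝ) : ℂ) * Complex.I))
                      else 1)) • (creation (orb x σ) * annihilation (orb y σ))
                  else 0)) ψ).re -
                d₀ * (Real.pi / 3) ^ 2 * (M : ℝ) / (2 * (L : ℝ)) :=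
  Summit.HubbardSuperconductivity.HubbardSuperconductivity.Theorems.WidthHaldane.stub_currentRigidity

/-- STUB 6 — CLOSED (landed `Theorems/WidthHaldaneTransverseFloor.lean`, 11:17Z, `transverseFloor_of_kineticFloor`). TRANSVERSE KINETIC FLOOR ON THE SQUARE TORUS (diagonal dividend): the kinetic floor (hypothesis, =
the matrix of STUB 2) applied to the SWAPPED labelling `e' = swap ∘ e` of the square tube `M = L` — same graph, same
Hamiltonian, same sector ground states — floors the TRANSVERSE kinetic energy as well:
`d₀ · L · L ≤ Σ_{a,b,σ} Re⟨ψ, (c†_{(a,b)σ} c_{(a,b-1)σ} + h.c.) ψ⟩`. -/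
theorem stub_transverseFloor :
    (∀ (U δ d₀ k₀ : ℝ) (M₁ L₀ : ℕ), 0 < d₀ → UniformThermo U δ d₀ k₀ M₁ L₀ →
      ∀ (L M : ℕ) [NeZero L] [NeZero M], Even L → Even M → M₁ ≤ M → M ≤ L → L₀ ≤ L → 3 ≤ L →
        ∀ (Λ : Type) [LinearOrder Λ] [Fintype Λ] (e : Λ ≃ ZMod L × ZMod M) (ψ : Fock (Orb Λ)),
          star ψ ⬝ᵥ ψ = 1 → IsGroundStateInSector (tubeH0 L M Λ e U) (tubeFilling L M δ) 0 ψ →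
            d₀ * (L : ℝ) * (M : ℝ) ≤
              ∑ a : ZMod L, ∑ b : ZMod M, ∑ σ : Fin 2,
                (expect (creation (orb (e.symm (a, b)) σ) * annihilation (orb (e.symm (a - 1, b)) σ) +
                  creation (orb (e.symm (a - 1, b)) σ) * annihilation (orb (e.symm (a, b)) σ)) ψ).re) →
    ∀ (U δ d₀ k₀ : ℝ) (M₁ L₀ : ℕ), 0 < d₀ → UniformThermo U δ d₀ k₀ M₁ L₀ →
      ∀ (L : ℕ) [NeZero L], Even L → M₁ ≤ L → L₀ ≤ L → 3 ≤ L →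
        ∀ (Λ : Type) [LinearOrder Λ] [Fintype Λ] (e : Λ ≃ ZMod L × ZMod L) (ψ : Fock (Orb Λ)),
          star ψ ⬝ᵥ ψ = 1 → IsGroundStateInSector (tubeH0 L L Λ e U) (tubeFilling L L δ) 0 ψ →
            d₀ * (L : ℝ) * (L : ℝ) ≤
              ∑ a : ZMod L, ∑ b : ZMod L, ∑ σ : Fin 2,
                (expect (creation (orb (e.symm (a, b)) σ) * annihilation (orb (e.symm (a, b - 1)) σ) +
                  creation (orb (e.symm (a, b - 1)) σ) * annihilation (orb (e.symm (a, b)) σ)) ψ).re :=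
  Summit.HubbardSuperconductivity.HubbardSuperconductivity.Theorems.WidthHaldane.stub_transverseFloor

/-- STUB 7 (LEAD; the open core — conjecture-strength, see the header). TWO-FLUID SELECTION: at every `(U, δ)` of the
window and for all data with `UniformThermo`, there are Haldane-law constants such that every normalised sector ground
state of every admissible tube which (i) carries the kinetic floor `d₀LM ≤ K_ψ`, (ii) has no weak cut, (iii) obeys
Leggett's harmonic floor, (iv) is current-rigid (STUB 5's inequality for every `ζ ⊥ ψ` in the sector), (v) is an
`η`-lowest-weight vector (`η_ε ψ = 0`, landed consequence of `0 < ẽ″`) and (vi), on the square torus `M = L`, carries the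
transverse kinetic floor too, satisfies the crux's floor `A·L·M²·r̂^{-Ξ√(ẽ″/ρ̃)/M} ≤ G_ψ(r)` for `R ≤ r̂`. Hypotheses
(i)–(vi) are consequences of UT and ground-state-ness (STUBS 2–6, `etaLowestWeight`), so this stub is EQUIVALENT to the
crux; it is the typed residual "classification of rigid
states of the isotropic pure tube", and at `M = L` it is 2D d-wave column-pair LRO. -/
theorem stub_twoFluidSelection :
    ∀ U : ℝ, 0 < U → ∀ δ ∈ Set.Ioo (0 : ℝ) (3 / 10), ∀ (d₀ k₀ : ℝ) (M₁ L₀ : ℕ), 0 < d₀ →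
      UniformThermo U δ d₀ k₀ M₁ L₀ →
        ∃ Ξ : ℝ, 0 < Ξ ∧ ∃ A : ℝ, 0 < A ∧ ∃ R M₂ L₁ : ℕ,
          ∀ (L M : ℕ) [NeZero L] [NeZero M], Even L → Even M → M₂ ≤ M → M ≤ L → L₁ ≤ L →
            ∀ (Λ : Type) [LinearOrder Λ] [Fintype Λ] (e : Λ ≃ ZMod L × ZMod M) (ψ : Fock (Orb Λ)),
              star ψ ⬝ᵥ ψ = 1 → IsGroundStateInSector (tubeH0 L M Λ e U) (tubeFilling L M δ) 0 ψ →
                d₀ * (L : ℝ) * (M : ℝ) ≤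
                  ∑ a : ZMod L, ∑ b : ZMod M, ∑ σ : Fin 2,
                    (expect (creation (orb (e.symm (a, b)) σ) * annihilation (orb (e.symm (a - 1, b)) σ) +
                      creation (orb (e.symm (a - 1, b)) σ) * annihilation (orb (e.symm (a, b)) σ)) ψ).re →
                (∀ a : ZMod L,
                  (Real.pi / 3) ^ 2 * d₀ * (M : ℝ) / (L : ℝ) ≤
                    ∑ b : ZMod M, ∑ σ : Fin 2,
                      (expect (creation (orb (e.symm (a, b)) σ) * annihilation (orb (e.symm (a - 1, b)) σ) +
                        creation (orb (e.symm (a - 1, b)) σ) * annihilation (orb (e.symm (a, b)) σ)) ψ).re) →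
                d₀ * (M : ℝ) * ∑ a : ZMod L, (∑ b : ZMod M, ∑ σ : Fin 2,
                  (expect (creation (orb (e.symm (a, b)) σ) * annihilation (orb (e.symm (a - 1, b)) σ) +
                    creation (orb (e.symm (a - 1, b)) σ) * annihilation (orb (e.symm (a, b)) σ)) ψ).re)⁻¹ ≤ (L : ℝ) →
                (∀ ζ : Fock (Orb Λ), ζ ∈ szSector (tubeFilling L M δ) (0 : ℝ) → star ζ ⬝ᵥ ψ = 0 →
                  -(2 * (star ζ ⬝ᵥ ((∑ x : Λ, ∑ y : Λ, ∑ σ : Fin 2,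
                      (if (tubeGraph e).Adj x y then
                        (1 - (if (e x).1 = (e y).1 + 1 ∧ (e x).2 = (e y).2
                            then Complex.exp (((Real.pi / 3 / L : ℝ) : ℂ) * Complex.I)
                          else if (e y).1 = (e x).1 + 1 ∧ (e x).2 = (e y).2
                            then Complex.exp (-(((Real.pi / 3 / L : ℝ) : ℂ) * Complex.I))
                          else 1)) • (creation (orb x σ) * annihilation (orb y σ))
                      else 0)) *ᵥ ψ)).re) -
                    (star ζ ⬝ᵥ ((tubeH0 L M Λ e U + ∑ x : Λ, ∑ y : Λ, ∑ σ : Fin 2,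
                      (if (tubeGraph e).Adj x y then
                        (1 - (if (e x).1 = (e y).1 + 1 ∧ (e x).2 = (e y).2
                            then Complex.exp (((Real.pi / 3 / L : ℝ) : ℂ) * Complex.I)
                          else if (e y).1 = (e x).1 + 1 ∧ (e x).2 = (e y).2
                            then Complex.exp (-(((Real.pi / 3 / L : ℝ) : ℂ) * Complex.I))
                          else 1)) • (creation (orb x σ) * annihilation (orb y σ))
                      else 0)) *ᵥ ζ)).re +
                    (tubeEnergy L M Λ e U 0 (tubeFilling L M δ) +
                        d₀ * (Real.pi / 3) ^ 2 * (M : ℝ) / (2 * (L : ℝ))) * (star ζ ⬝ᵥ ζ).re ≤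
                  (expect (∑ x : Λ, ∑ y : Λ, ∑ σ : Fin 2,
                      (if (tubeGraph e).Adj x y then
                        (1 - (if (e x).1 = (e y).1 + 1 ∧ (e x).2 = (e y).2
                            then Complex.exp (((Real.pi / 3 / L : ℝ) : ℂ) * Complex.I)
                          else if (e y).1 = (e x).1 + 1 ∧ (e x).2 = (e y).2
                            then Complex.exp (-(((Real.pi / 3 / L : ℝ) : ℂ) * Complex.I))
                          else 1)) • (creation (orb x σ) * annihilation (orb y σ))
                      else 0)) ψ).re -
                    d₀ * (Real.pi / 3) ^ 2 * (M : ℝ) / (2 * (L : ℝ))) →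
                etaLower (fun x => if ((e x).1.val + (e x).2.val) % 2 = 0 then (1 : ℤˣ) else -1) *ᵥ ψ = 0 →
                (M = L → d₀ * (L : ℝ) * (M : ℝ) ≤
                  ∑ a : ZMod L, ∑ b : ZMod M, ∑ σ : Fin 2,
                    (expect (creation (orb (e.symm (a, b)) σ) * annihilation (orb (e.symm (a, b - 1)) σ) +
                      creation (orb (e.symm (a, b - 1)) σ) * annihilation (orb (e.symm (a, b)) σ)) ψ).re) →
                ∀ r : ZMod L, R ≤ r.val → r.val + R ≤ L →
                  A * (L : ℝ) * (M : ℝ) ^ 2 * ((min r.val (L - r.val) : ℕ) : ℝ) ^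
                      (-(Ξ * Real.sqrt (tubePairCompressibility L M Λ e U δ / tubeStiffness L M Λ e U δ) / (M : ℝ))) ≤
                    tubeColumnPairCorr L M Λ e ψ r := by
  sorry

/-! ## Composition (kernel-checked, no `sorry` below this line) -/

/-- THE CRUX FROM THE STUBS, closed form: the transfer stubs discharge the hypotheses of the selection stub at every
admissible size, after enlarging the thresholds to `M₂ ⊔ M₁` and `L₁ ⊔ L₀ ⊔ 3`. [folklore] -/
theorem WidthHaldaneBridge_of_stubs : WidthHaldaneBridge := by
  rw [widthHaldaneBridge_iff]
  intro U hU δ hδ d₀ k₀ M₁ L₀ hd₀ hUT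
  obtain ⟨Ξ, hΞ, A, hA, R, M₂, L₁, hsel⟩ := stub_twoFluidSelection U hU δ hδ d₀ k₀ M₁ L₀ hd₀ hUT
  refine ⟨Ξ, hΞ, A, hA, R, max M₂ M₁, max L₁ (max L₀ 3), ?_⟩
  intro L M _ _ hLe hMe hM hML hL Λ _ _ e ψ hψ hGS r hr hrL
  have hM₂ : M₂ ≤ M := le_of_max_le_left hM
  have hM₁ : M₁ ≤ M := le_of_max_le_right hM
  have hL₁ : L₁ ≤ L := le_of_max_le_left hL
  have hL₀ : L₀ ≤ L := le_of_max_le_left (le_of_max_le_right hL)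
  have h3 : 3 ≤ L := le_of_max_le_right (le_of_max_le_right hL)
  -- (i) kinetic floor
  have hK := stub_kineticFloor stub_sharpBloch U δ d₀ k₀ M₁ L₀ hd₀ hUT L M hLe hMe hM₁ hML hL₀ h3 Λ e ψ hψ hGS
  -- (ii) no weak cut
  have hcut := stub_cutFloor U δ d₀ k₀ M₁ L₀ hd₀ hUT L M hLe hMe hM₁ hML hL₀ h3 Λ e ψ hψ hGS
  -- (iii) harmonic floor (positivity of the cut energies from (ii))
  have hpos : ∀ a : ZMod L, 0 < ∑ b : ZMod M, ∑ σ : Fin 2,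
      (expect (creation (orb (e.symm (a, b)) σ) * annihilation (orb (e.symm (a - 1, b)) σ) +
        creation (orb (e.symm (a - 1, b)) σ) * annihilation (orb (e.symm (a, b)) σ)) ψ).re := by
    intro a
    refine lt_of_lt_of_le ?_ (hcut a)
    have hL0 : (0 : ℝ) < L := by exact_mod_cast Nat.pos_of_ne_zero (NeZero.ne L)
    have hM0 : (0 : ℝ) < M := by exact_mod_cast Nat.pos_of_ne_zero (NeZero.ne M)
    positivity
  have hharm := stub_leggettFloor U δ d₀ k₀ M₁ L₀ hd₀ hUT L M hLe hMe hM₁ hML hL₀ h3 Λ e ψ hψ hGS hpos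
  -- (iv) current rigidity
  have hrig := fun ζ hζ hζψ =>
    stub_currentRigidity U δ d₀ k₀ M₁ L₀ hd₀ hUT L M hLe hMe hM₁ hML hL₀ h3 Λ e ψ ζ hψ hGS hζ hζψ
  -- (v) η-lowest weight from `0 < ẽ″` (landed `etaLowestWeight`)
  have hic : 0 < tubePairCompressibility L M Λ e U δ := (hUT L M hLe hMe hM₁ hML hL₀ Λ e).2.1
  have hη := etaLowestWeight L M hLe hMe Λ e U δ hδ.1 hic ψ hGS
  -- (vi) the transverse floor on the square torus (swapped labelling)
  have htr : M = L → d₀ * (L : ℝ) * (M : ℝ) ≤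
      ∑ a : ZMod L, ∑ b : ZMod M, ∑ σ : Fin 2,
        (expect (creation (orb (e.symm (a, b)) σ) * annihilation (orb (e.symm (a, b - 1)) σ) +
          creation (orb (e.symm (a, b - 1)) σ) * annihilation (orb (e.symm (a, b)) σ)) ψ).re := by
    intro hLM
    subst hLM
    exact stub_transverseFloor (stub_kineticFloor stub_sharpBloch) U δ d₀ k₀ M₁ L₀ hd₀ hUT M hMe hM₁ hL₀ h3 Λ e ψ
      hψ hGS
  exact hsel L M hLe hMe hM₂ hML hL₁ Λ e ψ hψ hGS hK hcut hharm hrig hη htr r hr hrL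

/-- SKELETON THEOREM: the crux BY NAME (`sorryAx` enters only through the `stub_*` theorems). [folklore] -/
theorem WidthHaldaneBridge_of : WidthHaldaneBridge :=
  WidthHaldaneBridge_of_stubs

end Summit.HubbardSuperconductivity.HubbardSuperconductivity.Cruxes.WidthHaldaneBridge.Lines.Sketch

end
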